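import Literature.NumberTheory.LFunctions.MatomakiRadziwillTaoT2
import Literature.NumberTheory.LFunctions.MatomakiRadziwillTaoTheorem17OfA2WithSq
import Literature.NumberTheory.LFunctions.MatomakiRadziwillTaoPropA3WindowSq
import HarnessLib

/-!
# Matomäki–Radziwiłł–Tao (2015), Theorem 1.7 as printed, from Khale's zero-free region

Topic `Literature/NumberTheory/LFunctions`.  Everything in this file is PROVED; no definitions, no named facts.

The named fact `MatomakiRadziwillTao2015_theorem17` (`TaoLogElliottTheorem23.lean`) is Theorem 1.7 of
Matomäki–Radziwiłł–Tao with the PRINTED rate: for `X ≥ H ≥ 10`, `1`-bounded multiplicative `g`,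
`sup_α ∫_0^X |∑_{x ≤ n ≤ x+H} g(n) e(αn)| dx ≤ C (e^{-M(g;X,Q)/20} + log log H/log H + (log X)^{-1/700}) HX`.
The tree proves the chain `Proposition A.3 ⟹ Theorem A.2 ⟹ Theorem 1.7` for A.3 as printed
(`MatomakiRadziwillTao2015_theorem17_of_propA3`) and, from Khale's explicit Vinogradov–Korobov region, A.3 with the
weaker middle term `(1+M)e^{-M/2}`, which only yields the rate `e^{-M/120}` (`MRT2015.theorem17With_of_khale`).
This file closes the gap to the printed statement, conditionally on Khale's theorem only:

* `MRT2015.propA3With_sq_of_T2half_of_window`, `MRT2015.propA3With_sq_of_T2half`,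
  `MRT2015.propA3With_sq_of_khale` — Proposition A.3 with middle term `K (1+M)² e^{-M}`, from the UNCONDITIONAL `L²`
  treatment of the window `|t - t₁| ≤ (log X)^{1/16}` (`MRT2015.integral_sq_restrDirichlet_window_le_sq`: Gallagher's
  lemma + the window form of the restricted Halász theorem) and the `𝒯₂` bound `MRT2015.T2half` (Khale);
* `MatomakiRadziwillTao2015_theorem17_of_khale : Khale2024_zeroFreeRegion → MatomakiRadziwillTao2015_theorem17` —
  by `MRT2015.theorem17_of_propA3With_sq` (major arcs with `κ = 3`: any middle term `≤ K(1+M)²e^{-M}` gives the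
  printed `e^{-M/20}`).

So `MatomakiRadziwillTao2015_theorem17_holds` is reduced to the single named fact `Khale2024_zeroFreeRegion`
(`VinogradovKorobovDirichlet.lean`), exactly like the rest of the Matomäki–Radziwiłł / Tao cone of the tree.

## References
* K. Matomäki, M. Radziwiłł, T. Tao, *An averaged form of Chowla's conjecture*, Algebra & Number Theory 9 (2015),
  Theorem 1.7; §2 (proof of Theorem 1.7 from Theorem 2.3); Appendix A (Theorem A.2, Proposition A.3).
  [cite: MatomakiRadziwillTao2015, Theorem 1.7] [cite: MatomakiRadziwillTao2015, Appendix A, Proposition A.3 (proof)]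
* T. Khale, *An explicit Vinogradov–Korobov zero-free region for Dirichlet L-functions*, Q. J. Math. 75 (2024).
  [cite: Khale2024, Theorem 1.1]
-/

noncomputable section

open Finset Real Complex Filter MeasureTheory
open scoped ComplexConjugate Classical

namespace Literature.NumberTheory.LFunctions

namespace MRT2015

open Sieve (SieveIntervalSystem minPretentiousDistSq minPretentiousDistSq_nonneg pretentiousDistSq)
open ArithmeticFunction

variable {η X₀ : ℝ}

/-- **Proposition A.3 with middle term `K (1 + M)² e^{-M}`, from the `L²` window bound and the bound on `𝒯₂`.**
Given the unconditional `L²` window bound (hypothesis `hWsq`, the statement of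
`MRT2015.integral_sq_restrDirichlet_window_le_sq`) and Matomäki–Radziwiłł's Proposition 1 for complex `f` away
from the minimiser in the form `T2half` (hypothesis `hT2`), `MRT2015.PropA3With (fun M => K (1 + M)² e^{-M})` holds for
some `K ≥ 0`.  The proof is that of `propA3With_exp_half_of_T2half` verbatim (trivial bound for `T ≥ X/2`; for
`T < X/2` split `[0, T]` at `clamp(t₁ ∓ (log X)^{1/16})` around a minimiser `t₁`, the hypothesis on the outer pieces,
the window bound on the middle piece). [cite: MatomakiRadziwillTao2015, Appendix A, Proposition A.3 (proof)] -/
theorem propA3With_sq_of_T2half_of_window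
    (hWsq : ∃ K : ℝ, 0 < K ∧ ∀ᶠ X : ℝ in atTop, ∀ (η X₀ : ℝ) (I : SieveIntervalSystem η X₀) (f : ℕ → ℂ),
      0 < η → η ≤ 1 → (∀ m n, f (m * n) = f m * f n) → f 1 = 1 → (∀ n, ‖f n‖ ≤ 1) →
      Real.sqrt X ≤ X₀ → X₀ ≤ X →
      ∀ (t₁ a b : ℝ),
        a ≤ b → t₁ - Real.log X ^ (1 / 16 : ℝ) ≤ a → b ≤ t₁ + Real.log X ^ (1 / 16 : ℝ) →
        -(X / 2) ≤ a → b ≤ X / 2 →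
        ∫ t in a..b, ‖restrDirichlet f I X t‖ ^ 2 ≤
          K * ((1 + minPretentiousDistSq f X X) ^ 2 * Real.exp (-minPretentiousDistSq f X X) +
            1 / Real.log X ^ (1 / 50 : ℝ)))
    (hT2 : ∀ η : ℝ, 0 < η → η < 1 / 6 → ∃ C Xη : ℝ, ∀ (X X₀ T₀ T t₁ : ℝ) (I : SieveIntervalSystem η X₀)
      (f : ArithmeticFunction ℂ), (∀ m n : ℕ, f (m * n) = f m * f n) → f 1 = 1 → (∀ n, ‖f n‖ ≤ 1) →
      Xη < X → Real.sqrt X ≤ X₀ → X₀ ≤ X → |t₁| ≤ X →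
      pretentiousDistSq f (fun n : ℕ => (n : ℂ) ^ ((t₁ : ℂ) * Complex.I)) X = minPretentiousDistSq f X X →
      0 ≤ T₀ → T₀ ≤ T → T ≤ X / 2 →
      (∀ t ∈ Set.Icc T₀ T, Real.log X ^ (1 / 16 : ℝ) ≤ |t - t₁|) →
      ∫ t in T₀..T, ‖restrDirichlet f I X t‖ ^ 2 ≤
        C * (T / (X / I.Q 1) + 1) *
          (Real.log (I.Q 1) ^ (1 / 3 : ℝ) / (I.P 1) ^ (1 / 6 - η) + 1 / Real.log X ^ (1 / 50 : ℝ))) :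
    ∃ K : ℝ, 0 ≤ K ∧ PropA3With (fun M => K * (1 + M) ^ 2 * Real.exp (-M)) := by
  obtain ⟨K, hK0, hWev⟩ := hWsq
  obtain ⟨Xw, hW⟩ := Filter.eventually_atTop.1 hWev
  refine ⟨K, hK0.le, ?_⟩
  intro η hη hη6
  obtain ⟨C₂, Xη, hT2'⟩ := hT2 η hη hη6
  refine ⟨2 * max C₂ 0 + K + 200, max (max Xη Xw) 64, ?_⟩
  intro X X₀ T I f hf hf1 hfb hXη hX₀ hX₀X hT0
  have hXη' : Xη < X := lt_of_le_of_lt ((le_max_left _ _).trans (le_max_left _ _)) hXη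
  have hXw : Xw ≤ X := ((le_max_right _ _).trans (le_max_left _ _)).trans hXη.le
  have hX64 : 64 ≤ X := (le_max_right _ _).trans hXη.le
  have hX0 : 0 < X := by linarith
  have hX1 : 1 ≤ X := by linarith
  have hη8 : η ≤ 8 := by linarith
  -- notation for the error terms
  set E₁ : ℝ := Real.log (I.Q 1) ^ (1 / 3 : ℝ) / I.P 1 ^ (1 / 6 - η) with hE₁
  set E₃ : ℝ := 1 / Real.log X ^ (1 / 50 : ℝ) with hE₃
  set M : ℝ := minPretentiousDistSq f X X with hMdef
  set mid : ℝ := K * (1 + M) ^ 2 * Real.exp (-M) with hmid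
  set R : ℝ := T / (X / I.Q 1) + 1 with hR
  have hQ1 : 1 ≤ I.Q 1 := I.one_le_Q hη hη8 le_rfl
  have hQ0 : 0 < I.Q 1 := by linarith
  have hlogX : 0 < Real.log X := Real.log_pos (by linarith)
  have hP0 : 0 < I.P 1 := I.pos_P 1 le_rfl
  have hE₁0 : 0 ≤ E₁ := by
    have : 0 ≤ Real.log (I.Q 1) := Real.log_nonneg hQ1
    positivity
  have hE₃0 : 0 ≤ E₃ := by positivity
  have hM0 : 0 ≤ M := minPretentiousDistSq_nonneg hfb X hX0.le
  have hmid0 : 0 ≤ mid := by positivity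
  have hR1 : 1 ≤ R := by
    have : 0 ≤ T / (X / I.Q 1) := by positivity
    linarith
  have hR0 : 0 ≤ R := by linarith
  have hRdef : R = T * I.Q 1 / X + 1 := by rw [hR]; field_simp
  have hC₂ : C₂ ≤ max C₂ 0 := le_max_left _ _
  have hC₂0 : 0 ≤ max C₂ 0 := le_max_right _ _
  -- the goal, restated
  show ∫ t in (0 : ℝ)..T, ‖restrDirichlet f I X t‖ ^ 2 ≤ (2 * max C₂ 0 + K + 200) * R * (E₁ + mid + E₃)
  have hcont : Continuous fun t : ℝ => ‖restrDirichlet f I X t‖ ^ 2 :=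
    ((continuous_restrDirichlet f I X).norm).pow 2
  have hint : ∀ a b : ℝ, IntervalIntegrable (fun t : ℝ => ‖restrDirichlet f I X t‖ ^ 2) volume a b :=
    fun a b => hcont.intervalIntegrable _ _
  have hnn : ∀ a b : ℝ, a ≤ b → 0 ≤ ∫ t in a..b, ‖restrDirichlet f I X t‖ ^ 2 := fun a b hab =>
    intervalIntegral.integral_nonneg hab fun t _ => by positivity
  rcases le_or_gt (X / 2) T with hTX | hTX
  · -- `T ≥ X/2`: the trivial bound
    have hT : 0 < T := by linarith
    have h1 := integral_restrDirichlet_trivial_le hfb I hX1 le_rfl hT0 hT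
    have h2 : 10 * T / X + 72 ≤ 154 * (T / X) := by
      have : 1 / 2 ≤ T / X := by rw [div_le_div_iff₀ (by norm_num) hX0]; linarith
      have h' : 10 * T / X = 10 * (T / X) := by ring
      rw [h']; linarith
    have h3 : T / X ≤ R * E₁ := by
      have h4 := one_le_Q_one_mul_err I hη hη6
      have hTX0 : 0 ≤ T / X := by positivity
      calc T / X = T / X * 1 := (mul_one _).symm
        _ ≤ T / X * (I.Q 1 * E₁) := mul_le_mul_of_nonneg_left h4 hTX0
        _ = (T * I.Q 1 / X) * E₁ := by ring
        _ ≤ R * E₁ := by rw [hRdef]; exact mul_le_mul_of_nonneg_right (by linarith) hE₁0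
    have h5 : R * E₁ ≤ R * (E₁ + mid + E₃) := mul_le_mul_of_nonneg_left (by linarith) hR0
    have h6 : 0 ≤ R * (E₁ + mid + E₃) := by positivity
    nlinarith
  · -- `T < X/2`: split `[0, T]`
    obtain ⟨t₁, ht₁, -, heq⟩ := Halasz.Restricted.exists_isMinOn_pretentiousDistSq_twist hfb X hX0.le
    set L : ℝ := Real.log X ^ (1 / 16 : ℝ) with hL
    have hL0 : 0 < L := Real.rpow_pos_of_pos hlogX _
    set a : ℝ := max 0 (min T (t₁ - L)) with ha
    set b : ℝ := max 0 (min T (t₁ + L)) with hb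
    have ha0 : 0 ≤ a := le_max_left _ _
    have hb0 : 0 ≤ b := le_max_left _ _
    have haT : a ≤ T := max_le hT0 (min_le_left _ _)
    have hbT : b ≤ T := max_le hT0 (min_le_left _ _)
    have hab : a ≤ b := max_le_max le_rfl (min_le_min le_rfl (by linarith))
    -- the three pieces
    rw [← intervalIntegral.integral_add_adjacent_intervals (hint 0 a) (hint a T),
      ← intervalIntegral.integral_add_adjacent_intervals (hint a b) (hint b T)]
    -- piece `[0, a]`
    have hA : ∫ t in (0 : ℝ)..a, ‖restrDirichlet f I X t‖ ^ 2 ≤ max C₂ 0 * R * (E₁ + E₃) := by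
      rcases eq_or_lt_of_le ha0 with h0 | h0
      · rw [← h0, intervalIntegral.integral_same]; positivity
      · -- `a > 0`: `a = min T (t₁ - L) ≤ t₁ - L`
        have ha' : a ≤ t₁ - L := by
          have : a = min T (t₁ - L) := max_eq_right (le_of_lt (by
            rcases lt_or_ge 0 (min T (t₁ - L)) with h' | h'
            · exact h'
            · exfalso; rw [ha, max_eq_left h'] at h0; exact lt_irrefl _ h0))
          rw [this]; exact min_le_right _ _
        have hfar : ∀ t ∈ Set.Icc 0 a, L ≤ |t - t₁| := by
          intro t ht
          rw [abs_sub_comm, abs_of_nonneg (by linarith [ht.2])]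
          linarith [ht.2]
        have h := hT2' X X₀ 0 a t₁ I f hf hf1 hfb hXη' hX₀ hX₀X ht₁ heq le_rfl ha0 (by linarith) hfar
        refine h.trans ?_
        have hRa : a / (X / I.Q 1) + 1 ≤ R := by
          rw [hR]; gcongr
        have hRa0 : 0 ≤ a / (X / I.Q 1) + 1 := by positivity
        have hEE : 0 ≤ E₁ + E₃ := by positivity
        calc C₂ * (a / (X / I.Q 1) + 1) * (E₁ + E₃) ≤ max C₂ 0 * (a / (X / I.Q 1) + 1) * (E₁ + E₃) := by
              gcongr
          _ ≤ max C₂ 0 * R * (E₁ + E₃) := by gcongr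
    -- piece `[b, T]`
    have hB : ∫ t in b..T, ‖restrDirichlet f I X t‖ ^ 2 ≤ max C₂ 0 * R * (E₁ + E₃) := by
      rcases eq_or_lt_of_le hbT with h0 | h0
      · rw [h0, intervalIntegral.integral_same]; positivity
      · -- `b < T`: `b = max 0 (t₁ + L) ≥ t₁ + L`
        have hb' : t₁ + L ≤ b := by
          have hmin : min T (t₁ + L) = t₁ + L := by
            rcases le_or_gt T (t₁ + L) with h' | h'
            · exfalso
              have : b = T := by rw [hb, min_eq_left h', max_eq_right hT0]
              exact lt_irrefl _ (this ▸ h0)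
            · exact min_eq_right h'.le
          rw [hb, hmin]; exact le_max_right _ _
        have hfar : ∀ t ∈ Set.Icc b T, L ≤ |t - t₁| := by
          intro t ht
          rw [abs_of_nonneg (by linarith [ht.1])]
          linarith [ht.1]
        have h := hT2' X X₀ b T t₁ I f hf hf1 hfb hXη' hX₀ hX₀X ht₁ heq hb0 hbT (by linarith) hfar
        refine h.trans ?_
        have hEE : 0 ≤ E₁ + E₃ := by positivity
        gcongr
    -- piece `[a, b]`: the window
    have hWin : ∫ t in a..b, ‖restrDirichlet f I X t‖ ^ 2 ≤ K * ((1 + M) ^ 2 * Real.exp (-M) + E₃) := by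
      rcases eq_or_lt_of_le hab with h0 | h0
      · rw [← h0, intervalIntegral.integral_same]; positivity
      · -- `a < b`: `a ≥ t₁ - L` (as `a < T`) and `b ≤ t₁ + L` (as `b > 0`)
        have ha' : t₁ - L ≤ a := by
          have haT' : a < T := lt_of_lt_of_le h0 hbT
          have hmin : min T (t₁ - L) = t₁ - L := by
            rcases le_or_gt T (t₁ - L) with h' | h'
            · exfalso
              have : a = T := by rw [ha, min_eq_left h', max_eq_right hT0]
              exact lt_irrefl _ (this ▸ haT')
            · exact min_eq_right h'.le
          rw [ha, hmin]; exact le_max_right _ _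
        have hb' : b ≤ t₁ + L := by
          have hb0' : 0 < b := lt_of_le_of_lt ha0 h0
          have : b = min T (t₁ + L) := max_eq_right (le_of_lt (by
            rcases lt_or_ge 0 (min T (t₁ + L)) with h' | h'
            · exact h'
            · exfalso; rw [hb, max_eq_left h'] at hb0'; exact lt_irrefl _ hb0'))
          rw [this]; exact min_le_right _ _
        exact hW X hXw η X₀ I f hη (by linarith) hf hf1 hfb hX₀ hX₀X t₁ a b hab ha' hb'
          (by linarith) (by linarith)
    -- combine
    have hWin' : K * ((1 + M) ^ 2 * Real.exp (-M) + E₃) ≤ R * (mid + K * E₃) := by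
      have h1 : K * ((1 + M) ^ 2 * Real.exp (-M) + E₃) = mid + K * E₃ := by rw [hmid]; ring
      rw [h1]
      exact le_mul_of_one_le_left (by positivity) hR1
    have hsum := add_le_add hA (add_le_add hWin hB)
    refine hsum.trans ?_
    clear hsum hA hB hWin hW hT2' hint hcont hnn heq
    have h1 : 0 ≤ max C₂ 0 * R * mid := by positivity
    have h2 : 0 ≤ K * R * E₁ := by positivity
    have h3 : 0 ≤ K * R * mid := by positivity
    have h4 : 0 ≤ R * mid := by positivity
    have h5 : 0 ≤ R * E₁ := by positivity
    have h6 : 0 ≤ R * E₃ := by positivity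
    linarith [hWin', h1, h2, h3, h4, h5, h6]


/-- **Proposition A.3 with middle term `K (1 + M)² e^{-M}`, from the bound on `𝒯₂`** (the window being
unconditional, `integral_sq_restrDirichlet_window_le_sq`). [cite: MatomakiRadziwillTao2015, Appendix A, Proposition A.3 (proof)] -/
theorem propA3With_sq_of_T2half
    (hT2 : ∀ η : ℝ, 0 < η → η < 1 / 6 → ∃ C Xη : ℝ, ∀ (X X₀ T₀ T t₁ : ℝ) (I : SieveIntervalSystem η X₀)
      (f : ArithmeticFunction ℂ), (∀ m n : ℕ, f (m * n) = f m * f n) → f 1 = 1 → (∀ n, ‖f n‖ ≤ 1) →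
      Xη < X → Real.sqrt X ≤ X₀ → X₀ ≤ X → |t₁| ≤ X →
      pretentiousDistSq f (fun n : ℕ => (n : ℂ) ^ ((t₁ : ℂ) * Complex.I)) X = minPretentiousDistSq f X X →
      0 ≤ T₀ → T₀ ≤ T → T ≤ X / 2 →
      (∀ t ∈ Set.Icc T₀ T, Real.log X ^ (1 / 16 : ℝ) ≤ |t - t₁|) →
      ∫ t in T₀..T, ‖restrDirichlet f I X t‖ ^ 2 ≤
        C * (T / (X / I.Q 1) + 1) *
          (Real.log (I.Q 1) ^ (1 / 3 : ℝ) / (I.P 1) ^ (1 / 6 - η) + 1 / Real.log X ^ (1 / 50 : ℝ))) :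
    ∃ K : ℝ, 0 ≤ K ∧ PropA3With (fun M => K * (1 + M) ^ 2 * Real.exp (-M)) :=
  propA3With_sq_of_T2half_of_window integral_sq_restrDirichlet_window_le_sq hT2

/-- **Proposition A.3 with middle term `K (1 + M)² e^{-M}`, from Khale's region**:
`∃ K ≥ 0, MRT2015.PropA3With (fun M => K (1 + M)² e^{-M})`. [cite: MatomakiRadziwillTao2015, Appendix A, Proposition A.3]
[cite: Khale2024, Theorem 1.1] -/
theorem propA3With_sq_of_khale (hK : Khale2024_zeroFreeRegion) :
    ∃ K : ℝ, 0 ≤ K ∧ PropA3With (fun M => K * (1 + M) ^ 2 * Real.exp (-M)) :=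
  propA3With_sq_of_T2half (T2half hK)

end MRT2015

/-- **Matomäki–Radziwiłł–Tao 2015, Theorem 1.7 as printed (rate `e^{-M(g;X,Q)/20}`), from Khale's explicit
Vinogradov–Korobov zero-free region.**  The chain: `𝒯₂` (MR Proposition 1 for complex `f`, Khale) + the `L²` window
(unconditional) ⟹ Proposition A.3 with middle term `K(1+M)²e^{-M}` ⟹ Theorem A.2 (`MRT2015.theoremA2With_of_propA3With`)
⟹ the major arcs with `κ = 3` and the minor arcs ⟹ Theorem 1.7 (`MRT2015.theorem17_of_propA3With_sq`).
[cite: MatomakiRadziwillTao2015, Theorem 1.7] [cite: Khale2024, Theorem 1.1] -/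
theorem MatomakiRadziwillTao2015_theorem17_of_khale (hK : Khale2024_zeroFreeRegion) :
    MatomakiRadziwillTao2015_theorem17 := by
  obtain ⟨K, hK0, hA3⟩ := MRT2015.propA3With_sq_of_khale hK
  exact MRT2015.theorem17_of_propA3With_sq (mid := fun M => K * (1 + M) ^ 2 * Real.exp (-M)) (K := K)
    (fun M _ => by positivity) (fun M _ => le_rfl) hA3

end Literature.NumberTheory.LFunctions

end
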